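import Summits.BirchSwinnertonDyer.Rank1Residual.X11b.LambdaSupplyTwistPrime
import Summits.BirchSwinnertonDyer.Rank1Residual.X11b.Three.LambdaSupply
import HarnessLib

/-!
# Class X11b, route p2 at a GENERAL odd prime `p`: the λ-SUPPLY — x11b3's S24-a
# (`Three.lambdaSupplyAt₃`) at EVERY ODD PRIME (cell `b2b-bsdres`, sub-cell `multr1-p2`, gen 25)

HONEST FRAMING (cell `b2b-bsdres`, run/shared/lean/b2b/bsd-rank1-residual/, verbatim in every
file): the goal of the cell is to DELETE the COMBINATION-SHAPED residual classes of the
Birch–Swinnerton-Dyer formula for ALL analytic-rank `≤ 1` elliptic curves over `ℚ` — "full BSD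
formula for every rank `≤ 1` curve in class `C`" assembled STRICTLY from published theorems — so
that the rank-`≤ 1` remainder becomes exactly the CONSTRUCTION-SHAPED classes, which are TYPED
(missing-input `Prop`s), NOT attempted. This is not "finishing BSD". Sub-cell `multr1-p2` is a
RESEARCH ROUTE on class X11b (`ClassX11b W p := r_an = 1 ∧ p ≠ 2 ∧ mult(p) ∧ irr(p)`); no claim
beyond the stated class and loci; X11b's label does not change; NOTHING is booked by this file.

THEOREMS ONLY (class field theory bookkeeping on the tree's Hecke characters / Galois characters;
no definition, no named fact, no `sorry`).

PROVENANCE / CREDIT: this file is team x11b3's S24-a assembly (`X11b/Three/LambdaSupply.lean`, seat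
`b2b-bsdres-x11b3-p7`, p264661: `LambdaSupply.exists_lambda_of_character`, `Three.lambdaSupplyAt₃`)
with `3 ↦ p`, `p` an ODD prime. The proof is theirs VERBATIM; every ingredient they built at a
general prime (parts (A) `exists_character_quotient_type_one` [x11b3-p2], (B)/(B-q)
`LambdaSupplyAvatar`/`LambdaSupplyQuotient` [x11b3-p2/p7], (C) `LambdaSupplyTransport` [x11b3-p2],
(E) `LambdaSupplyRankTwo`, (F-IIa) `LambdaSupplyWeilValues`, (D-II)/(D-III)
`LambdaSupplyTeichmueller`/`LambdaSupplyLogCoordinates` [x11b3-p7]) is IMPORTED, not restated; the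
two `p = 3` ingredients are replaced by their every-`p` forms of this sub-cell's gen 25
(`LambdaSupply.PadicUnits.norm_one_sub_lt_of_pow_prime_pow` /
`…exists_pow_mem_principalUnits_coprime` in `X11b/LambdaSupplyPadicUnitsPrime.lean`, and (F-I)′
`LambdaSupply.PadicUnits.exists_twists` (odd `p`) in `X11b/LambdaSupplyTwistPrime.lean`). Nothing of
x11b3's is touched, renamed or claimed; at `p = 3` the statement below is `Three.lambdaSupplyAt₃`
minus its unused splitting hypothesis.

## Why (route p2)

Route p2's open input is H∃♭ `P2.IMCDivIntFrameOnTree W p` (gen 24); its existence conjunct 3.1♭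
holds at every p2 datum from HSIEH 2014 Thm. 1 (PUBLISHED) modulo the λ-supply
(`P2.exists_isBDPLFunctionInt_of_hsieh2014`, hypothesis `hsup` = x11b3's S24-a statement AT THE
PRIME `p`). With **`X11b.lambdaSupplyAt`** below (every odd prime, every imaginary quadratic `K`,
every anticyclotomic `ℤ_p`-extension, every `ι' : ℚ̄_p ≃ ℂ`), `hsup` is DISCHARGED: see
`X11b/BDPRouteHsiehFrameSupplied.lean`.

## The theorems

* `LambdaSupply.exists_lambda_of_character` (odd `p`): `K` imaginary quadratic, `κ : Γ_K ↠ ℤ_p`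
  ANTICYCLOTOMIC, `ι : ℚ̄_p ≃ ℂ`, `σ_c ≠ 1`, `Ψ` an ALGEBRAIC Hecke character of `K` unramified
  outside `p` whose quotient `Ψ·(Ψ∘σ_c)⁻¹` is unitary of type `(1,-1)` ⟹ a pair `(λ, r_λ)` with the
  six clauses: `λ` unitary, of infinity type `(1,-1)`, trivial on `𝕀_ℚ`, unramified outside `p`,
  `r_λ` its `p`-adic avatar, `r_λ` FACTORS THROUGH `κ`. Proof (x11b3's quotient shape): `c ∈ Γ_ℚ ∖ Γ_K`
  with `c² = 1`, its lift `θ`; the rank-two basis `Φ₀, Φ₁`; Weil's character `a` of `Ψ` with values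
  in a finite `E/ℚ_p`; `S` = inertia at `v ∤ p` and its `θ`-translates (killed by `a`, `Φ₀`, `Φ₁`);
  the twists `ω, φ′` ((F-I)′, odd `p`); `u = aω⁻¹φ′⁻¹`, `g = u/(u∘θ)` principal-unit-valued, trivial
  on `ker Φ₀ ∩ ker Φ₁`, anti-invariant; LEMMA Λ′ (`apply_eq_one_of_anti`): `g` kills `ker κ`;
  finite-order Hecke characters `μ_ω, μ_φ′`; `Ψ′ = Ψ μ_ω μ_φ′`; `λ := Ψ′·(Ψ′∘σ_c)⁻¹`,
  `r_λ := e∘(ψ′(ψ′∘θ)⁻¹) = e∘g⁻¹` factors through `κ`.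
* **`X11b.lambdaSupplyAt`** (odd `p`): the λ-supply VERBATIM as consumed by route p2 — for every
  `ι' : ℚ̄_p ≃ ℂ`, every imaginary quadratic `K`, every anticyclotomic `κ`: `∃ (λ, r_λ)` with the six
  clauses. Proof: the core theorem fed with part (A)'s character at `p` (`2 ≤ p`) for `σ_c` = complex
  conjugation.

## References

* [Weil1956] A. Weil, *On a certain type of characters of the idèle-class group of an algebraic
  number-field*, §1–§2 (the `ℓ`-adic avatar of a character of type (A₀)).
* [Greenberg1987] R. Greenberg, *Non-vanishing of certain values of `L`-functions*, §2
  (anticyclotomic characters as quotients `Ψ/Ψ∘c`).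
* [Washington1997] L. C. Washington, *Introduction to Cyclotomic Fields*, §5.1, §13.1, Prop. 13.2.
-/

noncomputable section

open scoped NumberField
open NumberField IsDedekindDomain Field Filter Topology Polynomial
  Literature.NumberTheory.GaloisRepresentations Literature.NumberTheory.EllipticCurves
  Literature.NumberTheory.Automorphic

namespace Summit.BirchSwinnertonDyer.Rank1Residual.X11b.LambdaSupply

open Summit.BirchSwinnertonDyer.Rank1Residual.X11b.Three.LambdaSupply

variable {K : Type} [Field K] [NumberField K] {p : ℕ} [Fact p.Prime]

/-- **The anticyclotomic pair `(λ, r_λ)` from one algebraic Hecke character `Ψ`, at an ODD prime `p`.**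
See the module docstring for the statement and the proof (x11b3-p7's
`Three.LambdaSupply.exists_lambda_of_character` with `3 ↦ p`).
[cite: Weil1956, §1–§2] [cite: Greenberg1987, §2] [cite: Washington1997, §13.1] -/
theorem exists_lambda_of_character (hp2 : p ≠ 2) (ι : PadicAlgCl p ≃+* ℂ) (κ : ZpExtension K p)
    (hK : Module.finrank ℚ K = 2) (himag : ∀ w : InfinitePlace K, w.IsComplex)
    (hκ : κ.IsAnticyclotomic) {σc : K ≃ₐ[ℚ] K} (hσc : σc ≠ 1)
    {Ψ : HeckeCharacter K} (hΨa : Ψ.IsAlgebraic)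
    (hΨu : ∀ v : HeightOneSpectrum (𝓞 K), ((p : ℕ) : 𝓞 K) ∉ v.asIdeal → Ψ.IsUnramifiedAt v)
    (hunit : (Ψ * (HeckeCharacter.galConj σc Ψ)⁻¹).IsUnitary)
    (htype : (Ψ * (HeckeCharacter.galConj σc Ψ)⁻¹).HasInfinityType
      (fun _ ↦ (1 : ℤ)) (fun _ ↦ (-1 : ℤ))) :
    ∃ (lam : HeckeCharacter K) (rlam : FramedGaloisRep K (PadicAlgCl p) 1),
      lam.IsUnitary ∧ lam.HasInfinityType (fun _ ↦ (1 : ℤ)) (fun _ ↦ (-1 : ℤ)) ∧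
      (∀ x : ideleGroup ℚ, lam (AdeleRing.ideleBaseChange ℚ K x) = 1) ∧
      (∀ v : HeightOneSpectrum (𝓞 K), ((p : ℕ) : 𝓞 K) ∉ v.asIdeal → lam.IsUnramifiedAt v) ∧
      IsPAdicAvatarOf ι lam rlam ∧ FactorsThroughZp κ rlam := by
  classical
  haveI : Algebra.IsQuadraticExtension ℚ K := { finrank_eq_two' := hK }
  haveI : IsGalois ℚ K := inferInstance
  -- the currency `e : ℚ̄₃ˣ ≃ GL₁(ℚ̄₃)`
  set e := (FramedRep.unitsContinuousMulEquivOfUnique (Fin 1) (PadicAlgCl p) :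
    (PadicAlgCl p)ˣ →ₜ* GL (Fin 1) (PadicAlgCl p)) with he
  -- Step 1: `c`, its lift `θ`, and the rank-two basis
  obtain ⟨c, hc, hc2⟩ := exists_not_mem_range_absGaloisRestrict (L := K) (Rat.castHom ℝ) himag
  have hinj := absGaloisRestrict_injective ℚ K
  have hidx : ∀ ρ ρ' : absoluteGaloisGroup ℚ, ρ ∉ Set.range (absGaloisRestrict ℚ K) →
      ρ' ∉ Set.range (absGaloisRestrict ℚ K) → ρ⁻¹ * ρ' ∈ Set.range (absGaloisRestrict ℚ K) :=
    fun ρ ρ' hρ hρ' => inv_mul_mem_range_absGaloisRestrict hK hρ hρ'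
  obtain ⟨θ, hθ⟩ := ZpExtension.IndexTwo.exists_conjHom (absGaloisRestrict ℚ K) hinj hidx c
  have hθθ : ∀ σ, θ (θ σ) = σ := ZpExtension.IndexTwo.conjHom_conjHom hinj hc2 hθ
  obtain ⟨Φ₀, Φ₁, hsurj, hspan⟩ := exists_spanningPair (p := p) hK himag
  -- Step 2: Weil's character of `Ψ` with values in a finite `E/ℚ₃`
  obtain ⟨E, hEfd, a, ha, haΨ⟩ := exists_weilValued ι hΨa
  haveI : CompleteSpace E := FiniteDimensional.complete ℚ_[p] E
  set ιE : (E)ˣ →* (PadicAlgCl p)ˣ :=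
    Units.map ((algebraMap E (PadicAlgCl p) : E →+* PadicAlgCl p) : E →* PadicAlgCl p) with hιE
  have hιE_inj : Function.Injective ιE := fun x y hxy =>
    Units.ext (Subtype.ext (congrArg Units.val hxy))
  -- its currency `ψa` and the avatar `e ∘ ψa⁻¹` of `Ψ`
  obtain ⟨ψa, hψa⟩ := exists_unitsChar_of_continuous (p := p) a ha
  have hψa' : ∀ σ, ψa σ = ιE (a σ) := fun σ => Units.ext (hψa σ)
  have hΨav : IsPAdicAvatarOf ι Ψ (e.comp ψa⁻¹) := by
    rw [isPAdicAvatarOf_unitsChar_iff]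
    intro v hv hu
    obtain ⟨h1, h2⟩ := haΨ v hv hu
    refine ⟨fun 𝔓 h𝔓 σ hσ => ?_, fun 𝔓 h𝔓 Φ hΦ => ?_⟩
    · rw [unitsChar_inv_apply, hψa', h1 𝔓 h𝔓 σ hσ, map_one, inv_one]
    · rw [unitsChar_inv_apply, Units.val_inv_eq_inv_val, hψa, h2 𝔓 h𝔓 Φ hΦ]
  -- transport: `a ∘ θ` kills the inertia at `v ∤ p` too
  have haθ : ∀ v : HeightOneSpectrum (𝓞 K), ((p : ℕ) : 𝓞 K) ∉ v.asIdeal →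
      ∀ 𝔓 ∈ v.primesAbove, ∀ σ ∈ 𝔓.inertia (absoluteGaloisGroup K), a (θ σ) = 1 := by
    intro v hv 𝔓 h𝔓 σ hσ
    have ht := isPAdicAvatarOf_galConj_comp ι hΨav hθ
    have hunr := (ht v hv (isUnramifiedAt_galConj_of_forall (p := p) _ hΨu v hv)).1 𝔓 h𝔓 σ hσ
    rw [ContinuousMonoidHom.coe_comp, Function.comp_apply, ContinuousMonoidHom.coe_comp,
      Function.comp_apply] at hunr
    have h2 : ψa⁻¹ (θ σ) = 1 :=
      (map_eq_one_iff e (FramedRep.unitsContinuousMulEquivOfUnique (Fin 1) (PadicAlgCl p)).injective).mp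
        hunr
    rw [unitsChar_inv_apply, inv_eq_one, hψa'] at h2
    exact hιE_inj (by rw [h2, map_one])
  -- Step 3: the set `S` (inertia at `v ∤ p` and its `θ`-translates)
  set S : Set (absoluteGaloisGroup K) := {σ | ∃ v : HeightOneSpectrum (𝓞 K),
    ((p : ℕ) : 𝓞 K) ∉ v.asIdeal ∧ ∃ 𝔓 ∈ v.primesAbove,
      σ ∈ 𝔓.inertia (absoluteGaloisGroup K) ∨ θ σ ∈ 𝔓.inertia (absoluteGaloisGroup K)} with hS
  have hSθ : ∀ σ ∈ S, θ σ ∈ S := by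
    rintro σ ⟨v, hv, 𝔓, h𝔓, h | h⟩
    · exact ⟨v, hv, 𝔓, h𝔓, Or.inr (by rwa [hθθ])⟩
    · exact ⟨v, hv, 𝔓, h𝔓, Or.inl h⟩
  have haS : ∀ σ ∈ S, a σ = 1 := by
    rintro σ ⟨v, hv, 𝔓, h𝔓, h | h⟩
    · exact (haΨ v hv (hΨu v hv)).1 𝔓 h𝔓 σ h
    · rw [← hθθ σ]; exact haθ v hv 𝔓 h𝔓 _ h
  have hΦS : ∀ σ ∈ S, Φ₀ σ = 1 ∧ Φ₁ σ = 1 := by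
    rintro σ ⟨v, hv, 𝔓, h𝔓, h | h⟩
    · exact ⟨zpChar_apply_eq_one_of_mem_inertia Φ₀ hv h𝔓 h,
        zpChar_apply_eq_one_of_mem_inertia Φ₁ hv h𝔓 h⟩
    · have h0 := zpChar_apply_eq_one_of_mem_inertia (Φ₀.comp θ) hv h𝔓 h
      have h1 := zpChar_apply_eq_one_of_mem_inertia (Φ₁.comp θ) hv h𝔓 h
      rw [ContinuousMonoidHom.coe_comp, Function.comp_apply, hθθ] at h0 h1
      exact ⟨h0, h1⟩
  -- Step 4: the twists (F-I)
  obtain ⟨ω, φ', hωk, hφk, hωS, hφS, hgN, hgP⟩ :=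
    LambdaSupply.PadicUnits.exists_twists hp2 θ hθθ Φ₀ Φ₁ hsurj hspan a ha S hSθ haS hΦS
  have hωc : Continuous ω := PadicUnits.continuous_of_isOpen_ker' ω hωk
  have hφc : Continuous φ' := PadicUnits.continuous_of_isOpen_ker' φ' hφk
  set u : absoluteGaloisGroup K →* (E)ˣ := a * ω⁻¹ * φ'⁻¹ with hu
  set g : absoluteGaloisGroup K →* (E)ˣ := u * (u.comp θ.toMonoidHom)⁻¹ with hg
  have hg_apply : ∀ σ, g σ = u σ * (u (θ σ))⁻¹ := fun σ => rfl
  have hgN' : ∀ σ, Φ₀ σ = 1 → Φ₁ σ = 1 → g σ = 1 := fun σ h0 h1 => hgN σ h0 h1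
  have hanti : ∀ σ, g (θ σ) = (g σ)⁻¹ := fun σ => by
    rw [hg_apply, hg_apply, hθθ, mul_inv_rev, inv_inv]
  -- Step 5: LEMMA Λ′ — `g` kills `ker κ`
  have hgκ : ∀ σ, κ σ = 1 → g σ = 1 := fun σ hσ =>
    apply_eq_one_of_anti hK κ hκ hc hc2 hθ hsurj hspan g hgN' hanti
      {x : (E)ˣ | ‖1 - ((x : (E)ˣ) : E)‖ < 1}
      (fun x hx hxx => Units.ext (PadicUnits.eq_one_of_mul_self_eq_one (p := p) hp2 hx
        (by rw [← Units.val_mul, hxx, Units.val_one])))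
      (fun τ _ => hgP τ) σ hσ
  -- Step 6: the finite-order Hecke characters `μ_ω`, `μ_φ′`
  obtain ⟨ψω, hψω⟩ := exists_unitsChar_of_continuous (p := p) ω hωc
  obtain ⟨ψφ, hψφ⟩ := exists_unitsChar_of_continuous (p := p) φ' hφc
  have hψω' : ∀ σ, ψω σ = ιE (ω σ) := fun σ => Units.ext (hψω σ)
  have hψφ' : ∀ σ, ψφ σ = ιE (φ' σ) := fun σ => Units.ext (hψφ σ)
  have hkω : IsOpen (ψω.toMonoidHom.ker : Set (absoluteGaloisGroup K)) := by
    convert hωk using 1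
    ext σ
    simp only [SetLike.mem_coe, MonoidHom.mem_ker]
    exact unitsChar_eq_one_iff hψω σ
  have hkφ : IsOpen (ψφ.toMonoidHom.ker : Set (absoluteGaloisGroup K)) := by
    convert hφk using 1
    ext σ
    simp only [SetLike.mem_coe, MonoidHom.mem_ker]
    exact unitsChar_eq_one_iff hψφ σ
  obtain ⟨μω, hμω_fin, hμω_av, hμω_unr⟩ := exists_hecke_of_isOpen_ker ι ψω.toMonoidHom hkω
  obtain ⟨μφ, hμφ_fin, hμφ_av, hμφ_unr⟩ := exists_hecke_of_isOpen_ker ι ψφ.toMonoidHom hkφ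
  have hμω_av' : IsPAdicAvatarOf ι μω (e.comp ψω) :=
    (isPAdicAvatarOf_unitsChar_iff ι μω ψω).mpr hμω_av
  have hμφ_av' : IsPAdicAvatarOf ι μφ (e.comp ψφ) :=
    (isPAdicAvatarOf_unitsChar_iff ι μφ ψφ).mpr hμφ_av
  have hμω_u : ∀ v : HeightOneSpectrum (𝓞 K), ((p : ℕ) : 𝓞 K) ∉ v.asIdeal →
      μω.IsUnramifiedAt v :=
    fun v hv => hμω_unr v fun 𝔓 h𝔓 σ hσ =>
      (unitsChar_eq_one_iff hψω σ).mpr (hωS σ ⟨v, hv, 𝔓, h𝔓, Or.inl hσ⟩)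
  have hμφ_u : ∀ v : HeightOneSpectrum (𝓞 K), ((p : ℕ) : 𝓞 K) ∉ v.asIdeal →
      μφ.IsUnramifiedAt v :=
    fun v hv => hμφ_unr v fun 𝔓 h𝔓 σ hσ =>
      (unitsChar_eq_one_iff hψφ σ).mpr (hφS σ ⟨v, hv, 𝔓, h𝔓, Or.inl hσ⟩)
  -- Step 7: `Ψ′ = Ψ μ_ω μ_φ′` and its avatar `e ∘ ψ′`, `ψ′ = ψa⁻¹ ψω ψφ = ι_E ∘ u⁻¹`
  set Ψ' : HeckeCharacter K := Ψ * μω * μφ with hΨ'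
  set ψ' : absoluteGaloisGroup K →ₜ* (PadicAlgCl p)ˣ := ψa⁻¹ * ψω * ψφ with hψ'def
  have hΨ'u : ∀ v : HeightOneSpectrum (𝓞 K), ((p : ℕ) : 𝓞 K) ∉ v.asIdeal →
      Ψ'.IsUnramifiedAt v :=
    fun v hv => ((hΨu v hv).mul' (hμω_u v hv)).mul' (hμφ_u v hv)
  have hΨ'av : IsPAdicAvatarOf ι Ψ' (e.comp ψ') :=
    isPAdicAvatarOf_mul ι (isPAdicAvatarOf_mul ι hΨav hμω_av' (hram_of_forall hΨu hμω_u)) hμφ_av'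
      (hram_of_forall (fun v hv => (hΨu v hv).mul' (hμω_u v hv)) hμφ_u)
  have hψ'_apply : ∀ τ, ψ' τ = ιE (u τ)⁻¹ := fun τ => by
    show (ψa τ)⁻¹ * ψω τ * ψφ τ = ιE (a τ * (ω τ)⁻¹ * (φ' τ)⁻¹)⁻¹
    rw [hψa', hψω', hψφ', ← map_inv ιE, ← map_mul ιE, ← map_mul ιE]
    congr 1
    simp only [mul_inv_rev, inv_inv, mul_assoc, mul_comm, mul_left_comm]
  -- Step 8: `λ := Ψ′ (Ψ′ ∘ σ_c)⁻¹`, `r_λ := e ∘ (ψ′ (ψ′∘θ)⁻¹)`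
  refine ⟨Ψ' * (HeckeCharacter.galConj σc Ψ')⁻¹, e.comp (ψ' * (ψ'.comp θ)⁻¹), ?_, ?_,
    fun x => mul_galConj_inv_ideleBaseChange σc Ψ' x,
    fun v hv => isUnramifiedAt_mul_galConj_inv_of_forall (p := p) σc hΨ'u v hv,
    isPAdicAvatarOf_mul_galConj_inv_of_finrank_eq_two hK ι hΨ'av hΨ'u hc hθ hσc, ?_⟩
  -- the finite-order part `μ (μ ∘ σ_c)⁻¹`, `μ = μ_ω μ_φ′`
  · have hμ : (μω * μφ).IsFiniteOrder := hμω_fin.mul hμφ_fin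
    have heq : Ψ' * (HeckeCharacter.galConj σc Ψ')⁻¹ = (Ψ * (HeckeCharacter.galConj σc Ψ)⁻¹) *
        ((μω * μφ) * (HeckeCharacter.galConj σc (μω * μφ))⁻¹) := by
      rw [hΨ', mul_assoc Ψ, HeckeCharacter.galConj_mul, mul_inv, mul_mul_mul_comm]
    rw [heq]
    exact hunit.mul (hμ.isUnitary.mul (isUnitary_galConj σc hμ.isUnitary).inv)
  · have hμ : (μω * μφ).IsFiniteOrder := hμω_fin.mul hμφ_fin
    have heq : Ψ' * (HeckeCharacter.galConj σc Ψ')⁻¹ = (Ψ * (HeckeCharacter.galConj σc Ψ)⁻¹) *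
        ((μω * μφ) * (HeckeCharacter.galConj σc (μω * μφ))⁻¹) := by
      rw [hΨ', mul_assoc Ψ, HeckeCharacter.galConj_mul, mul_inv, mul_mul_mul_comm]
    rw [heq]
    have h0 := (hasInfinityType_zero_of_isFiniteOrder hμ).mul'
      (hasInfinityType_zero_of_isFiniteOrder (isFiniteOrder_galConj σc hμ)).inv
    have h := htype.mul' h0
    simpa only [neg_zero, add_zero] using h
  -- factorisation through `κ`: `ψ′ (ψ′∘θ)⁻¹ = ι_E ∘ g⁻¹`
  · rw [factorsThroughZp_unitsChar_iff]
    intro σ hσ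
    rw [ContinuousMonoidHom.mul_apply, unitsChar_inv_apply, ContinuousMonoidHom.coe_comp,
      Function.comp_apply, hψ'_apply, hψ'_apply, ← map_inv ιE, inv_inv, ← map_mul ιE,
      show (u σ)⁻¹ * u (θ σ) = (g σ)⁻¹ by rw [hg_apply, mul_inv_rev, inv_inv, mul_comm], hgκ σ hσ, inv_one,
      map_one]

end Summit.BirchSwinnertonDyer.Rank1Residual.X11b.LambdaSupply

namespace Summit.BirchSwinnertonDyer.Rank1Residual.X11b

open Summit.BirchSwinnertonDyer.Rank1Residual.X11b.Three.LambdaSupply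

/-- **The λ-SUPPLY at every ODD prime `p`, UNCONDITIONAL** (statement = the hypothesis `hsup` of
`P2.exists_isBDPLFunctionInt_of_hsieh2014` / `…_odd`, VERBATIM; at `p = 3` it is x11b3's
`Three.lambdaSupplyAt₃` without the unused splitting hypothesis): for every `ι' : ℚ̄_p ≃ ℂ`, every
imaginary quadratic field `K` and every ANTICYCLOTOMIC `ℤ_p`-extension `κ` of `K` there is a pair
`(λ, r_λ)` — `λ` a unitary Hecke character of `K` of infinity type `(1,-1)`, trivial on `𝕀_ℚ`,
unramified outside `p`, `r_λ` its `p`-adic avatar — with `r_λ` factoring through `κ`. Proof: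
`LambdaSupply.exists_lambda_of_character` with part (A)'s `Ψ` at `p`
(`Three.LambdaSupply.exists_character_quotient_type_one`, `2 ≤ p`), `K` being CM
(`IsCMField.ofCMExtension ℚ K`) with `σ_c` = complex conjugation
(`Three.LambdaSupply.restrictScalars_complexConj_ne_one`).
[cite: Weil1956, §1–§2] [cite: Greenberg1987, §2] [cite: Washington1997, §13.1] -/
theorem lambdaSupplyAt {p : ℕ} [Fact p.Prime] (hp2 : p ≠ 2) (ι' : PadicAlgCl p ≃+* ℂ)
    (K : Type) [Field K] [NumberField K] (κ : ZpExtension K p) (hK : IsImaginaryQuadratic K)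
    (hκ : κ.IsAnticyclotomic) :
    ∃ (lam : HeckeCharacter K) (rlam : FramedGaloisRep K (PadicAlgCl p) 1),
      lam.IsUnitary ∧ lam.HasInfinityType (fun _ ↦ (1 : ℤ)) (fun _ ↦ (-1 : ℤ)) ∧
      (∀ x : ideleGroup ℚ, lam (AdeleRing.ideleBaseChange ℚ K x) = 1) ∧
      (∀ v : HeightOneSpectrum (𝓞 K), ((p : ℕ) : 𝓞 K) ∉ v.asIdeal → lam.IsUnramifiedAt v) ∧
      IsPAdicAvatarOf ι' lam rlam ∧ FactorsThroughZp κ rlam := by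
  haveI : IsTotallyComplex K := hK.2
  haveI : Algebra.IsQuadraticExtension ℚ K := { finrank_eq_two' := hK.1 }
  haveI : IsCMField K := IsCMField.ofCMExtension ℚ K
  obtain ⟨Ψ, hΨa, hΨu, hunit, htype⟩ :=
    exists_character_quotient_type_one (K := K) hK.1 (p := p) (Fact.out : p.Prime).two_le
  exact LambdaSupply.exists_lambda_of_character hp2 ι' κ hK.1 IsTotallyComplex.isComplex hκ
    restrictScalars_complexConj_ne_one hΨa hΨu hunit htype

end Summit.BirchSwinnertonDyer.Rank1Residual.X11b

end
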